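import Literature.NumberTheory.EllipticCurves.FormalExpTaylorUniformizationProofs
import HarnessLib

/-!
# Pole clearing for the local parameter `t = -x/y` along the uniformisation on a disc
# (`t = N/D` near `0` with `N, D` analytic on `|z| < R`; proofs only)

Topic `Literature/NumberTheory/EllipticCurves`; a proofs-only file (theorems only). For a
Weierstrass model `W/ℂ`, a period pair `L` and a radius `R`, the meromorphic local parameter
`t(z) = -x(z)/y(z)` (`(x, y) = (℘ - b₂/12, (℘' - a₁x - a₃)/2)`, `t = 0` on `Λ`) of
`FormalExpTaylorUniformizationProofs` is written as a quotient `t = N/D` **near `0`** of two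
functions `N, D` **analytic on the whole disc `|z| < R`** with `D(0) ≠ 0`
(`exists_analyticOnNhd_localParam_eventuallyEq_div`): with `Λ_R` the (finite) set of lattice
points of norm `≤ R`,

  `D = ∏_{l ∈ Λ_R} (z - l)³ · (℘' - a₁x - a₃)`,  `N = -2 ∏_{l ∈ Λ_R} (z - l)³ · x`,

corrected at the lattice points by their limits (`-2∏_{l ≠ l₀}(l₀ - l)³`, resp. `0`), which are
analytic there because `(z - l₀)³℘' = (z - l₀)³℘'[L - l₀] - 2` and
`(z - l₀)²℘ = (z - l₀)²℘[L - l₀] + 1 - (z - l₀)²/l₀²` (Mathlib's `derivWeierstrassPExcept_sub`,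
`weierstrassPExcept_add`). This is the "pole-cleared" simultaneous uniformisation
`(φ, ψ) = (F/g, G/g)` on `D(0, R)` required by André's criterion in the tree's form
(`Transcendental/AndreCriterionAnalyticProofs`: `g, F, G` differentiable on `ball 0 R`,
`F =ᶠ[𝓝 0] g·φ`, `g 0 = 1`): for two curves take `g = D₁D₂/(D₁(0)D₂(0))`,
`F = N₁D₂/(D₁(0)D₂(0))`, `G = D₁N₂/(D₁(0)D₂(0))` (`exists_pole_clearing_pair`). Bost 2001, Thm.
2.3, condition ii): "condition ii)′ is satisfied by the restriction to `h_{σ₀}` of the exponential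
map of the complex Lie group `G_{σ₀}(ℂ)`" — the exponential is entire-meromorphic in the
coordinates `(t₁, t₂)`, so every radius `R` is available.

## References

* J.-B. Bost, Publ. Math. IHÉS 93 (2001), Thm. 2.1 ii), Thm. 2.3 (proof), Cor. 2.5.
  [Bost2001AlgebraicLeaves]
* A. Chambert-Loir, Sém. Bourbaki 886 (2002), §6.1 (uniformisation on a disc). [ChambertLoir2002Bourbaki]
-/

noncomputable section

open Filter Set Metric Finset
open scoped Topology Classical PeriodPair

namespace WeierstrassCurve

open PeriodPair

variable (L : PeriodPair) (W : WeierstrassCurve ℂ)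

/-- The lattice points of norm `≤ R` form a finite set. [folklore] -/
theorem _root_.Literature.NumberTheory.EllipticCurves.finite_lattice_norm_le (L : PeriodPair) (R : ℝ) :
    {l : L.lattice | ‖(l : ℂ)‖ ≤ R}.Finite := by
  have h : IsCompact (Metric.closedBall (0 : L.lattice) R) := isCompact_closedBall _ _
  refine (isCompact_iff_finite.mp h).subset fun l hl => ?_
  simpa [Metric.mem_closedBall, dist_zero_right] using hl

/-- A finite product of cubes `∏ (z - l)³` is analytic. [folklore] -/
theorem _root_.Literature.NumberTheory.EllipticCurves.analyticAt_prod_sub_pow {ι : Type*}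
    (s : Finset ι) (c : ι → ℂ) (k : ℕ) (z₀ : ℂ) :
    AnalyticAt ℂ (fun z => ∏ i ∈ s, (z - c i) ^ k) z₀ := by
  induction s using Finset.induction_on with
  | empty => simpa using analyticAt_const
  | insert a s ha ih =>
    simp only [Finset.prod_insert ha]
    exact ((analyticAt_id.sub analyticAt_const).pow k).mul ih

/-- **`t = N/D` near `0` with `N, D` analytic on `|z| < R`, `D(0) ≠ 0`** — pole clearing for the
local parameter `t = -x/y` along the uniformisation, on an arbitrary disc.
[cite: Bost2001AlgebraicLeaves, Thm. 2.3 (proof, condition ii))] -/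
theorem exists_analyticOnNhd_localParam_eventuallyEq_div (R : ℝ) :
    ∃ N D : ℂ → ℂ, AnalyticOnNhd ℂ N (ball 0 R) ∧ AnalyticOnNhd ℂ D (ball 0 R) ∧ D 0 ≠ 0 ∧
      ((fun z => if z ∈ L.lattice then (0 : ℂ) else
          -(℘[L] z - W.b₂ / 12) / ((℘'[L] z - W.a₁ * (℘[L] z - W.b₂ / 12) - W.a₃) / 2)) =ᶠ[𝓝 0]
        fun z => N z / D z) := by
  -- the finite set of lattice points in the closed disc
  set S : Finset L.lattice := (Literature.NumberTheory.EllipticCurves.finite_lattice_norm_le L R).toFinset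
    with hS
  have hmemS : ∀ l : L.lattice, l ∈ S ↔ ‖(l : ℂ)‖ ≤ R := fun l => by
    rw [hS, Set.Finite.mem_toFinset]; rfl
  -- the two functions
  set Dfun : ℂ → ℂ := fun z => ℘'[L] z - W.a₁ * (℘[L] z - W.b₂ / 12) - W.a₃ with hDfun
  set xfun : ℂ → ℂ := fun z => ℘[L] z - W.b₂ / 12 with hxfun
  set P : ℂ → ℂ := fun z => ∏ l ∈ S, (z - (l : ℂ)) ^ 3 with hP
  set D : ℂ → ℂ := fun z => if hz : z ∈ L.lattice then
      -2 * ∏ l ∈ S.erase ⟨z, hz⟩, (z - (l : ℂ)) ^ 3 else P z * Dfun z with hD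
  set N : ℂ → ℂ := fun z => if z ∈ L.lattice then 0 else -2 * P z * xfun z with hN
  have hPz : ∀ z, z ∉ L.lattice → P z ≠ 0 := by
    intro z hz
    rw [hP]
    refine Finset.prod_ne_zero_iff.mpr fun l _ => pow_ne_zero 3 (sub_ne_zero.mpr ?_)
    rintro rfl
    exact hz l.2
  -- analyticity off the lattice
  have hoff : ∀ z₀, z₀ ∉ L.lattice → AnalyticAt ℂ D z₀ ∧ AnalyticAt ℂ N z₀ := by
    intro z₀ hz₀
    have hopen : (L.lattice : Set ℂ)ᶜ ∈ 𝓝 z₀ := L.isClosed_lattice.isOpen_compl.mem_nhds hz₀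
    have hPa : AnalyticAt ℂ P z₀ := by
      rw [hP]; exact Literature.NumberTheory.EllipticCurves.analyticAt_prod_sub_pow _ _ 3 z₀
    have hwp : AnalyticAt ℂ ℘[L] z₀ := L.analyticOnNhd_weierstrassP z₀ hz₀
    have hwp' : AnalyticAt ℂ ℘'[L] z₀ := L.analyticOnNhd_derivWeierstrassP z₀ hz₀
    have hDa : AnalyticAt ℂ Dfun z₀ := by rw [hDfun]; fun_prop
    have hxa : AnalyticAt ℂ xfun z₀ := by rw [hxfun]; fun_prop
    constructor
    · refine (hPa.mul hDa).congr ?_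
      filter_upwards [hopen] with z hz
      have hz' : z ∉ L.lattice := hz
      simp only [hD, dif_neg hz', Pi.mul_apply]
    · have : AnalyticAt ℂ (fun z => -2 * P z * xfun z) z₀ := by fun_prop
      refine this.congr ?_
      filter_upwards [hopen] with z hz
      have hz' : z ∉ L.lattice := hz
      simp only [hN, if_neg hz']
  -- analyticity at a lattice point of the disc
  have hon : ∀ z₀ (hz₀ : z₀ ∈ L.lattice), (⟨z₀, hz₀⟩ : L.lattice) ∈ S →
      AnalyticAt ℂ D z₀ ∧ AnalyticAt ℂ N z₀ := by
    intro z₀ hz₀ hzS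
    have hnhds : ((L.lattice : Set ℂ) \ {z₀})ᶜ ∈ 𝓝 z₀ := L.compl_lattice_sdiff_singleton_mem_nhds z₀
    have hE : AnalyticAt ℂ ℘[L - z₀] z₀ := L.analyticAt_weierstrassPExcept z₀
    have hE' : AnalyticAt ℂ ℘'[L - z₀] z₀ := L.analyticAt_derivWeierstrassPExcept z₀
    have hPa : AnalyticAt ℂ (fun z => ∏ l ∈ S.erase ⟨z₀, hz₀⟩, (z - (l : ℂ)) ^ 3) z₀ :=
      Literature.NumberTheory.EllipticCurves.analyticAt_prod_sub_pow _ _ 3 z₀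
    have hPsplit : ∀ z, P z = (z - z₀) ^ 3 * ∏ l ∈ S.erase ⟨z₀, hz₀⟩, (z - (l : ℂ)) ^ 3 := by
      intro z
      rw [hP]
      exact (Finset.mul_prod_erase S (fun l : L.lattice => (z - (l : ℂ)) ^ 3) hzS).symm
    -- `℘, ℘'` through their analytic parts at `z₀`
    have hP1 : ∀ z, ℘[L] z = ℘[L - z₀] z + (1 / (z - z₀) ^ 2 - 1 / z₀ ^ 2) := fun z =>
      (L.weierstrassPExcept_add ⟨z₀, hz₀⟩ z).symm
    have hP2 : ∀ z, ℘'[L] z = ℘'[L - z₀] z - 2 / (z - z₀) ^ 3 := fun z =>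
      (L.derivWeierstrassPExcept_sub ⟨z₀, hz₀⟩ z).symm
    -- the analytic representatives
    set Afun : ℂ → ℂ := fun z => (z - z₀) ^ 3 * (℘'[L - z₀] z - W.a₁ * (℘[L - z₀] z - 1 / z₀ ^ 2 -
      W.b₂ / 12) - W.a₃) - 2 - W.a₁ * (z - z₀) with hAfun
    set Bfun : ℂ → ℂ := fun z => (z - z₀) ^ 3 * (℘[L - z₀] z - 1 / z₀ ^ 2 - W.b₂ / 12) + (z - z₀)
      with hBfun
    have hAa : AnalyticAt ℂ Afun z₀ := by rw [hAfun]; fun_prop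
    have hBa : AnalyticAt ℂ Bfun z₀ := by rw [hBfun]; fun_prop
    constructor
    · have : AnalyticAt ℂ (fun z => (∏ l ∈ S.erase ⟨z₀, hz₀⟩, (z - (l : ℂ)) ^ 3) * Afun z) z₀ :=
        hPa.mul hAa
      refine this.congr ?_
      filter_upwards [hnhds] with z hz
      by_cases hzz : z = z₀
      · subst hzz
        simp only [hD, dif_pos hz₀, hAfun, sub_self, zero_pow three_ne_zero, zero_mul, zero_sub,
          mul_zero, sub_zero]
        ring
      · have hzΛ : z ∉ L.lattice := fun h => hz ⟨h, hzz⟩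
        have hz3 : (z - z₀) ≠ 0 := sub_ne_zero.mpr hzz
        simp only [hD, dif_neg hzΛ, hPsplit z, hDfun, hAfun, hP1 z, hP2 z]
        field_simp
        ring
    · have : AnalyticAt ℂ (fun z => -2 * (∏ l ∈ S.erase ⟨z₀, hz₀⟩, (z - (l : ℂ)) ^ 3) * Bfun z) z₀ :=
        (analyticAt_const.mul hPa).mul hBa
      refine this.congr ?_
      filter_upwards [hnhds] with z hz
      by_cases hzz : z = z₀
      · subst hzz
        simp only [hN, if_pos hz₀, hBfun, sub_self, zero_pow three_ne_zero, zero_mul, zero_add,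
          mul_zero]
      · have hzΛ : z ∉ L.lattice := fun h => hz ⟨h, hzz⟩
        have hz3 : (z - z₀) ≠ 0 := sub_ne_zero.mpr hzz
        simp only [hN, if_neg hzΛ, hPsplit z, hxfun, hBfun, hP1 z]
        field_simp
        ring
  refine ⟨N, D, fun z hz => ?_, fun z hz => ?_, ?_, ?_⟩
  · by_cases hzΛ : z ∈ L.lattice
    · refine (hon z hzΛ ((hmemS _).mpr ?_)).2
      exact (mem_ball_zero_iff.mp hz).le
    · exact (hoff z hzΛ).2
  · by_cases hzΛ : z ∈ L.lattice
    · refine (hon z hzΛ ((hmemS _).mpr ?_)).1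
      exact (mem_ball_zero_iff.mp hz).le
    · exact (hoff z hzΛ).1
  · -- `D 0 ≠ 0`
    simp only [hD, dif_pos (zero_mem L.lattice)]
    refine mul_ne_zero (by norm_num) (Finset.prod_ne_zero_iff.mpr fun l hl => pow_ne_zero 3 ?_)
    rw [zero_sub, neg_ne_zero]
    intro h
    have : l = ⟨0, zero_mem _⟩ := Subtype.ext h
    exact (Finset.mem_erase.mp hl).1 this
  · -- `t = N/D` near `0`
    filter_upwards [L.compl_lattice_sdiff_singleton_mem_nhds 0] with z hz
    by_cases hzz : z = 0
    · subst hzz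
      simp only [hN, if_pos (zero_mem L.lattice), zero_div]
    · have hzΛ : z ∉ L.lattice := fun h => hz ⟨h, hzz⟩
      simp only [hN, hD, if_neg hzΛ, dif_neg hzΛ, hxfun, hDfun]
      have hP0 := hPz z hzΛ
      by_cases hDz : ℘'[L] z - W.a₁ * (℘[L] z - W.b₂ / 12) - W.a₃ = 0
      · simp [hDz]
      · field_simp

/-- **Pole clearing for a pair** — the data `(g, F, G)` of a simultaneous uniformisation on
`D(0, R)` in the form of the tree's André criterion (`AndreCriterionAnalyticProofs`,
`norm_coeff_le_of_coeff_lt_eq_zero`): for two Weierstrass models with period pairs there are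
`g, F, G` analytic on `|z| < R` with `g(0) = 1`, `F = g·t₁` and `G = g·t₂` near `0`, where
`tᵢ = -xᵢ/yᵢ` are the local parameters along the uniformisations.
[cite: Bost2001AlgebraicLeaves, Thm. 2.3 (proof, condition ii))] -/
theorem exists_pole_clearing_pair (L₁ L₂ : PeriodPair) (W₁ W₂ : WeierstrassCurve ℂ) {R : ℝ}
    (hR : 0 < R) :
    ∃ g F G : ℂ → ℂ, AnalyticOnNhd ℂ g (ball 0 R) ∧ AnalyticOnNhd ℂ F (ball 0 R) ∧
      AnalyticOnNhd ℂ G (ball 0 R) ∧ g 0 = 1 ∧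
      (F =ᶠ[𝓝 0] g * fun z => if z ∈ L₁.lattice then (0 : ℂ) else
          -(℘[L₁] z - W₁.b₂ / 12) / ((℘'[L₁] z - W₁.a₁ * (℘[L₁] z - W₁.b₂ / 12) - W₁.a₃) / 2)) ∧
      (G =ᶠ[𝓝 0] g * fun z => if z ∈ L₂.lattice then (0 : ℂ) else
          -(℘[L₂] z - W₂.b₂ / 12) / ((℘'[L₂] z - W₂.a₁ * (℘[L₂] z - W₂.b₂ / 12) - W₂.a₃) / 2)) := by
  obtain ⟨N₁, D₁, hN₁, hD₁, hD₁0, ht₁⟩ := exists_analyticOnNhd_localParam_eventuallyEq_div L₁ W₁ R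
  obtain ⟨N₂, D₂, hN₂, hD₂, hD₂0, ht₂⟩ := exists_analyticOnNhd_localParam_eventuallyEq_div L₂ W₂ R
  set c := D₁ 0 * D₂ 0 with hc
  have hc0 : c ≠ 0 := mul_ne_zero hD₁0 hD₂0
  refine ⟨fun z => D₁ z * D₂ z / c, fun z => N₁ z * D₂ z / c, fun z => D₁ z * N₂ z / c,
    fun z hz => ((hD₁ z hz).mul (hD₂ z hz)).div analyticAt_const hc0,
    fun z hz => ((hN₁ z hz).mul (hD₂ z hz)).div analyticAt_const hc0,
    fun z hz => ((hD₁ z hz).mul (hN₂ z hz)).div analyticAt_const hc0,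
    by rw [hc]; exact div_self hc0, ?_, ?_⟩
  · have hD : ∀ᶠ z in 𝓝 0, D₁ z ≠ 0 := (hD₁ 0 (mem_ball_self hR)).continuousAt.eventually_ne hD₁0
    filter_upwards [hD, ht₁] with z hz htz
    simp only [Pi.mul_apply, htz]
    field_simp
  · have hD : ∀ᶠ z in 𝓝 0, D₂ z ≠ 0 := (hD₂ 0 (mem_ball_self hR)).continuousAt.eventually_ne hD₂0
    filter_upwards [hD, ht₂] with z hz htz
    simp only [Pi.mul_apply, htz]
    field_simp

end WeierstrassCurve

end
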